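import Literature.Analysis.SegalBargmann.FockInfinitesimalAction
import Literature.Analysis.SegalBargmann.FockLadderAdjoint

/-!
# The derived action `dΓ` is a `*`-preserving Lie algebra representation of `𝔤𝔩(n, ℂ)` on the polynomial core of the Fock space (after Folland 1989, Ch. 4 §§4–5)

Source followed: G. B. Folland, *Harmonic Analysis in Phase Space*, Ch. 4 §4 (the infinitesimal representation,
`dμ(𝒜) = d/dt μ(e^{t𝒜})|_{t=0}` before Thm (4.45), restricted to the compact part `U(n)` of Prop (4.39)) and §5
(invariance of the `𝓟_k`), cited by item; built on `FockInfinitesimalAction` and `FockLadderAdjoint`.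

`FockInfinitesimalAction` differentiated the unitary action `ν₀(U)F = F ∘ U⁻¹` of `U(σ)` on the Fock space (Folland
Prop (4.39), the factor `det^{-1/2}` discarded as in the remark after it) along differentiable paths and found the
generator `dΓ(X) = −Σ_{j,k} X_{jk} z_k ∂_j` (`dGamma`) on polynomial vectors.  `FockLadderAdjoint` proved Folland's
adjointness of `z_j` and `∂/∂z_j` on the core (§1.6, the exercise after (1.75)).  This file records the three
structural facts that make `dΓ` an honest infinitesimal version of `ν₀|U(σ)` (no cited facts):

1. (§1) the `𝔤𝔩(σ)` commutation relations of the generators `E_{kj} = z_k ∂_j` (`mulXPDeriv k j`):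
   `[E_{kj}, E_{k'j'}] = δ_{k'j} E_{kj'} − δ_{kj'} E_{k'j}` (`mulXPDeriv_comm`), uniformly in a finite index type `σ`;
2. (§2) `dΓ(e_{ij}) = −E_{ji}` and **`dGammaLie : 𝔤𝔩(σ,ℂ) →ₗ⁅ℂ⁆ End_ℂ ℂ[z_σ]`**, `dΓ([X,Y]) = [dΓ(X), dΓ(Y)]`
   (`dGamma_commutator` states it without brackets);
3. (§3) the `*`-property on the polynomial core of `FockL2 σ`: **`⟪dΓ(X)F, G⟫_𝓕 = ⟪F, dΓ(Xᴴ)G⟫_𝓕`**; hence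
   for `X ∈ 𝔲(σ)` (`Xᴴ = −X`) the generator is skew-symmetric on the core and `Re ⟪dΓ(X)F, F⟫_𝓕 = 0` — the
   infinitesimal unitarity of `ν₀`;
4. (§4) `dΓ(X)` preserves each `𝓟_k` (Folland Ch. 4 §5: "Each `𝓟_k` is obviously invariant under the natural action
   of the unitary group"): homogeneity of degree `k` is preserved, and `fockToL2 (dΓ(X)F) ∈ degSpan {k}` — the
   infinitesimal form of `degSpan_invariant` (`FockKFinite`).

## What is NOT in this file

Algebra on the polynomial core only — no essential skew-adjointness, no Stone-generator statement; the
identification of `dΓ` on `σ = Fin 3` with the polarisation representation of the summit-side files is not made here.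

The commutator bracket on the associative algebras `Matrix σ σ ℂ`, `Module.End ℂ _` (a `def` in Mathlib) is enabled
by `attribute [local instance 100] LieRing.ofAssociativeRing`; `attribute [local instance 10000]
InnerProductSpace.toInner` pins the `Inner ℂ (FockL2 σ)` spelling as explained in `FockLadderAdjoint`.

## References

* [Folland1989] G. B. Folland, *Harmonic Analysis in Phase Space*, Annals of Mathematics Studies 122, Princeton
  University Press, 1989, Prop (4.39), Ch. 4 §4 (before Thm (4.45)), Ch. 4 §5 (doi:10.1515/9781400882427).

Filed under the LEAN-IN-TREE rule (2026-08-18) by seat pv05-g8 from the HodgeCM/PerL working package file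
`HodgeCM/PerL34/FockInfinitesimalLie.lean` (origin seat pv05-g7); statements and proofs unchanged except that the
one summit-specific consistency lemma (`σ = Fin 3`, comparing `dΓ` with the package's polarisation representation)
and its import are omitted; namespace `HodgeCM.PerL34.Fock.Hermite` ↦ `Literature.Analysis.SegalBargmann`.
-/

noncomputable section

open MeasureTheory Complex MvPolynomial Matrix
open scoped Real ComplexConjugate InnerProductSpace

namespace Literature.Analysis.SegalBargmann

-- Commutator bracket on the associative algebras `Matrix σ σ ℂ`, `Module.End ℂ _` (a `def` in Mathlib; enabled
-- locally).
attribute [local instance 100] LieRing.ofAssociativeRing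

-- See `FockLadderAdjoint`: pin `Inner ℂ (FockL2 σ)` to the `InnerProductSpace` path (definitionally equal to the
-- `WithCStarModule` path that instance search otherwise prefers) so that the generic `inner_*` lemmas rewrite.
attribute [local instance 10000] InnerProductSpace.toInner

variable {σ : Type*} [Fintype σ] [DecidableEq σ]

/-! ## 1. The `𝔤𝔩(σ)` commutation relations of `E_{kj} = z_k ∂_j` -/

omit [Fintype σ] in
/-- **`[z_k∂_j, z_{k'}∂_{j'}] = δ_{k'j} z_k∂_{j'} − δ_{kj'} z_{k'}∂_j`.** [folklore] -/
theorem mulXPDeriv_comm (k j k' j' : σ) :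
    mulXPDeriv k j * mulXPDeriv k' j' - mulXPDeriv k' j' * mulXPDeriv k j
      = (if k' = j then mulXPDeriv k j' else 0) - (if k = j' then mulXPDeriv k' j else 0) := by
  refine LinearMap.ext fun F => ?_
  have hc : pderiv j' (pderiv j F) = pderiv j (pderiv j' F) := pderiv_pderiv_comm j' j F
  simp only [LinearMap.sub_apply, Module.End.mul_apply, mulXPDeriv_apply, Derivation.leibniz, smul_eq_mul,
    pderiv_X, Pi.single_apply, hc]
  split_ifs <;> simp only [LinearMap.zero_apply, mulXPDeriv_apply] <;> ring

omit [Fintype σ] in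
/-- The `𝔤𝔩(σ)` commutation relations of `E_{kj} = z_k ∂_j`, bracket form: `⁅E_{kj}, E_{k'j'}⁆ =
δ_{k'j} E_{kj'} − δ_{kj'} E_{k'j}`. [folklore] -/
theorem mulXPDeriv_lie (k j k' j' : σ) :
    ⁅mulXPDeriv k j, mulXPDeriv k' j'⁆
      = (if k' = j then mulXPDeriv k j' else 0) - (if k = j' then mulXPDeriv k' j else 0) := by
  rw [LieRing.of_associative_ring_bracket, mulXPDeriv_comm]

/-! ## 2. `dΓ` on matrix units and diagonal matrices; the Lie algebra homomorphism -/

/-- `dΓ(e_{ij}) = −z_j ∂_i` (note the transposition built into `dΓ(X) = −Σ X_{jk} z_k∂_j`).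
[folklore] -/
theorem dGamma_single (i j : σ) (c : ℂ) : dGamma (Matrix.single i j c) = -(c • mulXPDeriv j i) := by
  rw [dGamma]
  congr 1
  rw [Finset.sum_eq_single i, Finset.sum_eq_single j, Matrix.single_apply_same]
  · intro k _ hk
    rw [Matrix.single_apply_of_ne, zero_smul]
    exact fun h => hk h.2.symm
  · intro h; exact absurd (Finset.mem_univ j) h
  · intro j' _ hj'
    refine Finset.sum_eq_zero fun k _ => ?_
    rw [Matrix.single_apply_of_ne, zero_smul]
    exact fun h => hj' h.1.symm
  · intro h; exact absurd (Finset.mem_univ i) h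

/-- `dΓ(diag d) = −Σ_j d_j z_j∂_j` (a weighted Euler operator; `d = 1` is `dGamma_one_of_isHomogeneous` of `FockInfinitesimalAction`).
[folklore] -/
theorem dGamma_diagonal (d : σ → ℂ) : dGamma (Matrix.diagonal d) = -∑ j, d j • mulXPDeriv j j := by
  rw [dGamma]
  congr 1
  refine Finset.sum_congr rfl fun j _ => ?_
  rw [Finset.sum_eq_single j, Matrix.diagonal_apply_eq]
  · intro k _ hk
    rw [Matrix.diagonal_apply_ne _ (fun h => hk h.symm), zero_smul]
  · intro h; exact absurd (Finset.mem_univ j) h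

/-- Matrix units: `e_{ij} e_{kl} = δ_{jk} e_{il}`. [folklore] -/
private theorem single_mul_single_eq_ite (i j k l : σ) :
    Matrix.single i j (1 : ℂ) * Matrix.single k l 1 = if j = k then Matrix.single i l 1 else 0 := by
  split_ifs with h
  · subst h; rw [Matrix.single_mul_single_same, mul_one]
  · rw [Matrix.single_mul_single_of_ne (h := h)]

/-- The bracket relation on matrix units: `[dΓ(e_{ij}), dΓ(e_{kl})] = dΓ([e_{ij}, e_{kl}])`.
[folklore] -/
theorem dGamma_comm_single (i j k l : σ) :
    dGamma (Matrix.single i j (1 : ℂ)) * dGamma (Matrix.single k l 1)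
        - dGamma (Matrix.single k l 1) * dGamma (Matrix.single i j 1)
      = dGamma (Matrix.single i j 1 * Matrix.single k l 1 - Matrix.single k l 1 * Matrix.single i j 1) := by
  have e : ∀ f g : MvPolynomial σ ℂ →ₗ[ℂ] MvPolynomial σ ℂ, -f * -g = f * g := fun f g => neg_mul_neg f g
  rw [dGamma_single, dGamma_single, one_smul, one_smul, e, e, mulXPDeriv_comm, single_mul_single_eq_ite,
    single_mul_single_eq_ite, ← dGammaHom_apply, map_sub, apply_ite dGammaHom, apply_ite dGammaHom, map_zero,
    dGammaHom_apply, dGammaHom_apply, dGamma_single, dGamma_single, one_smul, one_smul]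
  split_ifs <;> abel

/-- **The derived action is a Lie algebra representation of `𝔤𝔩(σ, ℂ)` on `ℂ[z_σ]`:** `dΓ([X,Y]) = [dΓ(X), dΓ(Y)]`
(kernel-checked on matrix units via `dGamma_comm_single`, extended bilinearly).
[folklore] -/
def dGammaLie : Matrix σ σ ℂ →ₗ⁅ℂ⁆ Module.End ℂ (MvPolynomial σ ℂ) :=
  { dGammaHom with
    map_lie' := by
      intro A B
      let L₁ : Matrix σ σ ℂ →ₗ[ℂ] Matrix σ σ ℂ →ₗ[ℂ] Module.End ℂ (MvPolynomial σ ℂ) :=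
        LinearMap.mk₂ ℂ (fun A B => dGammaHom ⁅A, B⁆) (fun A₁ A₂ B => by rw [add_lie, map_add])
          (fun c A B => by rw [smul_lie, map_smul]) (fun A B₁ B₂ => by rw [lie_add, map_add])
          (fun c A B => by rw [lie_smul, map_smul])
      let L₂ : Matrix σ σ ℂ →ₗ[ℂ] Matrix σ σ ℂ →ₗ[ℂ] Module.End ℂ (MvPolynomial σ ℂ) :=
        LinearMap.mk₂ ℂ (fun A B => ⁅dGammaHom A, dGammaHom B⁆) (fun A₁ A₂ B => by rw [map_add, add_lie])
          (fun c A B => by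
            simp only [map_smul, LieRing.of_associative_ring_bracket, smul_sub, smul_mul_assoc, mul_smul_comm])
          (fun A B₁ B₂ => by rw [map_add, lie_add])
          (fun c A B => by
            simp only [map_smul, LieRing.of_associative_ring_bracket, smul_sub, smul_mul_assoc, mul_smul_comm])
      have key : L₁ = L₂ := by
        refine LinearMap.ext_basis (Matrix.stdBasis ℂ σ σ) (Matrix.stdBasis ℂ σ σ) fun p q => ?_
        obtain ⟨i, j⟩ := p
        obtain ⟨k, l⟩ := q
        simp only [L₁, L₂, LinearMap.mk₂_apply, Matrix.stdBasis_eq_single, LieRing.of_associative_ring_bracket,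
          dGammaHom_apply]
        exact (dGamma_comm_single i j k l).symm
      exact LinearMap.congr_fun₂ key A B }

/-- Unfolding of the Lie algebra morphism `A ↦ dΓ(A)`. [folklore] -/
@[simp] theorem dGammaLie_apply (A : Matrix σ σ ℂ) : dGammaLie A = dGamma A := rfl

/-- `dΓ([X, Y]) = dΓ(X) dΓ(Y) − dΓ(Y) dΓ(X)`, stated without Lie brackets. [folklore] -/
theorem dGamma_commutator (A B : Matrix σ σ ℂ) :
    dGamma (A * B - B * A) = dGamma A * dGamma B - dGamma B * dGamma A := by
  have h := (dGammaLie (σ := σ)).map_lie A B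
  rwa [LieRing.of_associative_ring_bracket, LieRing.of_associative_ring_bracket, dGammaLie_apply, dGammaLie_apply,
    dGammaLie_apply] at h

/-! ## 3. The `*`-property of `dΓ` on the polynomial core of the Fock space -/

omit [DecidableEq σ] in
/-- `dΓ(A)F·e^{−(π/2)|z|²} = −Σ_{j,k} A_{jk} (z_k ∂_j F)·e^{−(π/2)|z|²}` in the Fock space.
[folklore] -/
theorem fockToL2_dGamma (A : Matrix σ σ ℂ) (F : MvPolynomial σ ℂ) :
    fockToL2 (dGamma A F) = -∑ j, ∑ k, A j k • fockToL2 (X k * pderiv j F) := by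
  rw [dGamma_apply, map_neg, map_sum]
  congr 1
  refine Finset.sum_congr rfl fun j _ => ?_
  rw [map_sum]
  exact Finset.sum_congr rfl fun k _ => map_smul _ _ _

omit [DecidableEq σ] in
/-- **`⟪dΓ(X)F, G⟫_𝓕 = ⟪F, dΓ(Xᴴ)G⟫_𝓕`** on polynomial vectors: `dΓ(X)^* ⊇ dΓ(Xᴴ)` on the core (from
`⟪z_k∂_jF, G⟫_𝓕 = ⟪F, z_j∂_kG⟫_𝓕`, `FockLadderAdjoint`). [folklore] -/
theorem inner_fockToL2_dGamma (A : Matrix σ σ ℂ) (F G : MvPolynomial σ ℂ) :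
    ⟪fockToL2 (dGamma A F), fockToL2 G⟫_ℂ = ⟪fockToL2 F, fockToL2 (dGamma Aᴴ G)⟫_ℂ := by
  rw [fockToL2_dGamma, fockToL2_dGamma, inner_neg_left, inner_neg_right, sum_inner, inner_sum]
  simp_rw [sum_inner, inner_sum]
  rw [Finset.sum_comm]
  refine congr_arg Neg.neg (Finset.sum_congr rfl fun a _ => Finset.sum_congr rfl fun b _ => ?_)
  rw [inner_smul_left (E := FockL2 σ), inner_smul_right (E := FockL2 σ), Matrix.conjTranspose_apply,
    Complex.star_def, inner_fockToL2_X_mul_pderiv]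

omit [DecidableEq σ] in
/-- **Skew-symmetry of the generator for `X ∈ 𝔲(σ)`:** if `Xᴴ = −X` then `⟪dΓ(X)F, G⟫_𝓕 = −⟪F, dΓ(X)G⟫_𝓕` on the
core — the derivative at `t = 0` of the unitarity `⟪ν₀(e^{tX})F, ν₀(e^{tX})G⟫ = ⟪F, G⟫` (Folland Prop (4.39)).
[folklore] -/
theorem inner_fockToL2_dGamma_of_star_eq_neg {A : Matrix σ σ ℂ} (hA : star A = -A) (F G : MvPolynomial σ ℂ) :
    ⟪fockToL2 (dGamma A F), fockToL2 G⟫_ℂ = -⟪fockToL2 F, fockToL2 (dGamma A G)⟫_ℂ := by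
  rw [inner_fockToL2_dGamma, ← Matrix.star_eq_conjTranspose, hA, dGamma_neg, LinearMap.neg_apply, map_neg,
    inner_neg_right]

omit [DecidableEq σ] in
/-- For `X ∈ 𝔲(σ)`: `Re ⟪dΓ(X)F, F⟫_𝓕 = 0` (`dΓ(X)` is "`i` × symmetric" on the core). [folklore] -/
theorem re_inner_fockToL2_dGamma_self {A : Matrix σ σ ℂ} (hA : star A = -A) (F : MvPolynomial σ ℂ) :
    (⟪fockToL2 (dGamma A F), fockToL2 F⟫_ℂ).re = 0 := by
  have h := inner_fockToL2_dGamma_of_star_eq_neg hA F F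
  rw [← inner_conj_symm (fockToL2 F) (fockToL2 (dGamma A F))] at h
  have h2 := congrArg Complex.re h
  rw [Complex.neg_re, Complex.conj_re] at h2
  linarith

/-- In particular each `E_{jk} − E_{kj}`-type and `i(E_{jk} + E_{kj})`-type generator is skew on the core; the
simplest instance: for a real diagonal `d`, `⟪dΓ(i·diag d)F, G⟫ = −⟪F, dΓ(i·diag d)G⟫`.
[folklore] -/
theorem inner_fockToL2_dGamma_I_diagonal (d : σ → ℝ) (F G : MvPolynomial σ ℂ) :
    ⟪fockToL2 (dGamma (Matrix.diagonal fun j => I * d j) F), fockToL2 G⟫_ℂ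
      = -⟪fockToL2 F, fockToL2 (dGamma (Matrix.diagonal fun j => I * d j) G)⟫_ℂ := by
  refine inner_fockToL2_dGamma_of_star_eq_neg ?_ F G
  rw [Matrix.star_eq_conjTranspose, Matrix.diagonal_conjTranspose, Matrix.diagonal_neg]
  congr 1
  funext j
  simp [Pi.star_apply, Complex.conj_ofReal]

/-! ## 4. `dΓ(X)` preserves Folland's `𝓟_k` -/

omit [Fintype σ] [DecidableEq σ] in
/-- `z_k ∂_j` preserves homogeneity of each degree. [folklore] -/
theorem isHomogeneous_X_mul_pderiv {F : MvPolynomial σ ℂ} {n : ℕ} (h : F.IsHomogeneous n) (k j : σ) :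
    (X k * pderiv j F).IsHomogeneous n := by
  obtain _ | n := n
  · rw [← totalDegree_zero_iff_isHomogeneous, totalDegree_eq_zero_iff_eq_C] at h
    rw [h, pderiv_C, mul_zero]
    exact isHomogeneous_zero σ ℂ 0
  · have := (isHomogeneous_X ℂ k).mul (h.pderiv (i := j))
    rwa [Nat.add_sub_cancel, add_comm] at this

omit [DecidableEq σ] in
/-- **`dΓ(X)𝓟_k ⊆ 𝓟_k`**: the derived action preserves homogeneity of each degree. [folklore] -/
theorem isHomogeneous_dGamma (A : Matrix σ σ ℂ) {F : MvPolynomial σ ℂ} {n : ℕ} (h : F.IsHomogeneous n) :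
    (dGamma A F).IsHomogeneous n := by
  rw [dGamma_apply]
  refine (homogeneousSubmodule σ ℂ n).neg_mem (Submodule.sum_mem _ fun j _ => Submodule.sum_mem _ fun k _ =>
    Submodule.smul_mem _ _ ?_)
  exact isHomogeneous_X_mul_pderiv h k j

omit [DecidableEq σ] in
/-- The Hilbert-space form: for `F ∈ 𝓟_k`, `(dΓ(X)F) e^{−(π/2)|z|²} ∈ degSpan {k}` (cf. `degSpan_invariant` for the
group action, `FockKFinite`). [folklore] -/
theorem fockToL2_dGamma_mem_degSpan (A : Matrix σ σ ℂ) {F : MvPolynomial σ ℂ} {k : ℕ} (h : F.IsHomogeneous k) :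
    fockToL2 (dGamma A F) ∈ degSpan (σ := σ) {k} :=
  fockToL2_mem_degSpan fun _ hγ => mdeg_eq_of_mem_support_of_isHomogeneous (isHomogeneous_dGamma A h) hγ

end Literature.Analysis.SegalBargmann

end
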